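import Summits.MatrixMultiplication.OmegaCensus.Z4Z4DominoSevenTables
import HarnessLib

/-!
# No domino cube law triple with a part of size `7` over `A ↠ ℤ₄ × ℤ₄`

ω-census `pub-omega`, family (b3), seat pub-omega-group gen 16.  Framing: lottery ticket; floor = certified bounds/negative
ranges.  VALUE: a kernel theorem about the group-theoretic method (TPP capacity of dihedral-like groups) closing an infinite
column of census cells; NOT progress on ω.

**Theorem (`no_shifted_form_seven_of_onto_z4z4`).** Let `A` be a finite abelian group mapping onto `ZMod 4 × ZMod 4`.  There
is no shifted domino form `(X+Y) ⊔ (β+(Y−X)) ⊔ (γ+(X−Y)) = A∖{x₀}` (`X + Y` direct) with `|X| = 7` (or, `'`, with `|Y| = 7`).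
The TPP corollaries (no `(1,1 | 7,7 | e,e)` / `(1,1 | d,d | 7,7)` law triple in any dihedral-like group over such `A`) and
the census cells are in `DominoPartSevenZ4Z4Cells.lean`.

*Proof* (gen 14/15's character method; the killing pair of characters is new).  For every pulled-back character `ψ_w`,
`a b + ψ(β) ā b + ψ(γ) a b̄ = −ψ(x₀)`.  Pigeonhole gives `x₁, x₂ ∈ X` congruent mod `2`; translate by `x₁`.  In coordinates
`w, w'` dual to `(φβ', φγ)` (`β' = β − 2x₁`) each real character `2v` takes the value `1` on one or two of the other five
points (`int_eq_of_mul_eq_neg_ipow`: the real sum `2 + #1's − #(−1)'s` divides a unit), so (`three_parts_shape`) the five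
points split into the classes `P₁ = (m even, n odd)`, `P₂ = (m odd, n even)`, `P₃ = (m, n odd)` with sizes `(1,2,2)`,
`(2,1,2)` or `(2,2,1)`.  For the characters `w'` (`ψβ' = 1`, `ψγ = i`) and `w' + 2w` (`ψβ' = −1`, `ψγ = i`) eliminating `b̄`
gives `D b = N` with an integer `D`, and the tables `table7A/B/C` (`Z4Z4DominoSevenTables.lean`) show that for one of the
two `N` is not divisible by `D`.  ∎
-/

namespace Summit.MatrixMultiplication.OmegaCensus

open Finset

section Main

variable {A : Type*} [AddCommGroup A] [Fintype A] [DecidableEq A]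

/-- **Core theorem.**  `A ↠ ZMod 4 × ZMod 4`; `X` of size `7`, `β, γ, x₀` with `X + Y` direct and
`(X+Y) ⊔ (β + (Y−X)) ⊔ (γ + (X−Y)) = A ∖ {x₀}`.  Then `False`. [folklore] -/
theorem no_shifted_form_seven_of_onto_z4z4 (φ : A →+ ZMod 4 × ZMod 4) (hφ : Function.Surjective φ)
    {X Y : Finset A} {β γ x₀ : A} (hX : X.card = 7)
    (hinj : Set.InjOn (fun p : A × A => p.1 + p.2) ↑(X ×ˢ Y))
    (hPQ : Disjoint ((X ×ˢ Y).image fun p : A × A => p.1 + p.2)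
      (((Y ×ˢ X).image fun p : A × A => p.1 - p.2).image fun z => z + β))
    (hPR : Disjoint ((X ×ˢ Y).image fun p : A × A => p.1 + p.2)
      (((X ×ˢ Y).image fun p : A × A => p.1 - p.2).image fun z => z + γ))
    (hQR : Disjoint (((Y ×ˢ X).image fun p : A × A => p.1 - p.2).image fun z => z + β)
      (((X ×ˢ Y).image fun p : A × A => p.1 - p.2).image fun z => z + γ))
    (hcover : ((X ×ˢ Y).image fun p : A × A => p.1 + p.2) ∪
      (((Y ×ˢ X).image fun p : A × A => p.1 - p.2).image fun z => z + β) ∪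
      (((X ×ˢ Y).image fun p : A × A => p.1 - p.2).image fun z => z + γ) = univ.erase x₀) : False := by
  classical
  -- the pulled-back characters `ψ w a = i^⟨w, φ a⟩` as an opaque local function
  obtain ⟨ψ, hψ⟩ : ∃ ψ : ZMod 4 × ZMod 4 → A → GaussianInt,
      ∀ w a, ψ w a = (⟨0, 1⟩ : GaussianInt) ^ (w.1 * (φ a).1 + w.2 * (φ a).2).val := ⟨_, fun _ _ => rfl⟩
  have hψadd : ∀ w a b, ψ w (a + b) = ψ w a * ψ w b := fun w a b => by
    rw [hψ, hψ, hψ]; exact z4char_add φ w a b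
  have hψneg : ∀ w a, ψ w (-a) = star (ψ w a) := fun w a => by rw [hψ, hψ]; exact z4char_neg φ w a
  have hψsub : ∀ w a b, ψ w (a - b) = ψ w a * star (ψ w b) := fun w a b => by
    rw [sub_eq_add_neg, hψadd, hψneg]
  have hψsum : ∀ w, w ≠ 0 → ∑ a, ψ w a = 0 := fun w hw => by
    simp only [hψ]; exact z4char_sum_eq_zero φ hφ w hw
  have hunit : ∀ w a, ψ w a * star (ψ w a) = 1 := fun w a => by
    have h := Zsqrtd.norm_eq_mul_conj (ψ w a)
    rw [hψ, norm_ipow] at h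
    rw [hψ, ← h, Int.cast_one]
  have hψ2 : ∀ (v : ZMod 4 × ZMod 4) (a : A),
      ψ (v + v) a = (⟨0, 1⟩ : GaussianInt) ^ (2 * (v.1 * (φ a).1 + v.2 * (φ a).2)).val := fun v a => by
    rw [hψ, z4pair_two]
  -- the identity `(E_w)` for every `w ≠ 0`
  have E : ∀ w : ZMod 4 × ZMod 4, w ≠ 0 →
      (∑ x ∈ X, ψ w x) * (∑ v ∈ Y, ψ w v) + ψ w β * star (∑ x ∈ X, ψ w x) * (∑ v ∈ Y, ψ w v) +
        ψ w γ * (∑ x ∈ X, ψ w x) * star (∑ v ∈ Y, ψ w v) + ψ w x₀ = 0 := by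
    intro w hw
    have h := shifted_form_charsum (ψ w) (hψadd w) hinj hPQ hPR hQR hcover
    rw [hψsum w hw] at h
    simp only [hψneg] at h
    rw [star_sum, star_sum]
    linear_combination -h
  -- pigeonhole: two points of `X` in the same class mod `2`
  obtain ⟨x₁, hx₁, x₂, hx₂, hne12, hcl⟩ := exists_ne_map_eq_of_card_lt_of_maps_to
    (f := fun a : A => ((2 * (φ a).1, 2 * (φ a).2) : ZMod 4 × ZMod 4))
    (t := ({(0, 0), (0, 2), (2, 0), (2, 2)} : Finset (ZMod 4 × ZMod 4))) (by rw [hX]; decide)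
    (fun a _ => two_mul_pair_mem (φ a))
  -- the other five points
  have hx₂' : x₂ ∈ X.erase x₁ := mem_erase.2 ⟨hne12.symm, hx₂⟩
  set X' : Finset A := (X.erase x₁).erase x₂ with hX'
  have hX'c : X'.card = 5 := by rw [hX', card_erase_of_mem hx₂', card_erase_of_mem hx₁, hX]
  have hsumX : ∀ w, ∑ x ∈ X, ψ w x = ψ w x₁ + ψ w x₂ + ∑ y ∈ X', ψ w y := by
    intro w; rw [hX', ← add_sum_erase X _ hx₁, ← add_sum_erase (X.erase x₁) _ hx₂', add_assoc]
  -- translated data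
  obtain ⟨d₂, hd₂⟩ : ∃ d : A, d = x₂ - x₁ := ⟨_, rfl⟩
  obtain ⟨β', hβ'⟩ : ∃ b : A, b = β - x₁ - x₁ := ⟨_, rfl⟩
  obtain ⟨e₀, he₀⟩ : ∃ e : A, e = x₀ - x₁ := ⟨_, rfl⟩
  have hterm : ∀ w y, ψ w y = ψ w x₁ * ψ w (y - x₁) := fun w y => by rw [← hψadd]; congr 1; abel
  have hsumX' : ∀ w, ∑ x ∈ X, ψ w x = ψ w x₁ * (1 + ψ w d₂ + ∑ y ∈ X', ψ w (y - x₁)) := by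
    intro w
    rw [hsumX, hterm w x₂, ← hd₂, mul_add, mul_add, mul_one, mul_sum]
    congr 1
    exact sum_congr rfl fun y _ => hterm w y
  -- `(E'_w)`: the identity after translating by `x₁`
  have E' : ∀ w : ZMod 4 × ZMod 4, w ≠ 0 →
      (1 + ψ w d₂ + ∑ y ∈ X', ψ w (y - x₁)) * (∑ v ∈ Y, ψ w v) +
        ψ w β' * star (1 + ψ w d₂ + ∑ y ∈ X', ψ w (y - x₁)) * (∑ v ∈ Y, ψ w v) +
        ψ w γ * (1 + ψ w d₂ + ∑ y ∈ X', ψ w (y - x₁)) * star (∑ v ∈ Y, ψ w v) = -ψ w e₀ := by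
    intro w hw
    have h := E w hw
    rw [hsumX' w, star_mul] at h
    rw [hβ', he₀, hψsub, hψsub, hψsub]
    linear_combination (star (ψ w x₁)) * h -
      ((1 + ψ w d₂ + ∑ y ∈ X', ψ w (y - x₁)) * (∑ v ∈ Y, ψ w v) +
        ψ w γ * (1 + ψ w d₂ + ∑ y ∈ X', ψ w (y - x₁)) * star (∑ v ∈ Y, ψ w v)) * (hunit w x₁)
  -- `ψ_{2v}(d₂) = 1`
  have hcl1 : 2 * (φ d₂).1 = 0 := by
    have h1 := congrArg Prod.fst hcl
    simp only at h1
    rw [hd₂, map_sub, Prod.fst_sub, mul_sub, h1, sub_self]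
  have hcl2 : 2 * (φ d₂).2 = 0 := by
    have h1 := congrArg Prod.snd hcl
    simp only at h1
    rw [hd₂, map_sub, Prod.snd_sub, mul_sub, h1, sub_self]
  have htwo : ∀ w : ZMod 4 × ZMod 4, 2 * (w.1 * (φ d₂).1 + w.2 * (φ d₂).2) = 0 := fun w => by
    linear_combination w.1 * hcl1 + w.2 * hcl2
  have hd₂real : ∀ w : ZMod 4 × ZMod 4, ψ (w + w) d₂ = 1 := fun w => by
    rw [hψ, z4pair_two, htwo, ZMod.val_zero, pow_zero]
  -- real characters
  have hreal2 : ∀ w : ZMod 4 × ZMod 4, ∀ a, star (ψ (w + w) a) = ψ (w + w) a := fun w a => by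
    rw [hψ, z4pair_two, star_ipow_two_mul]
  have hrealY : ∀ w : ZMod 4 × ZMod 4, star (∑ v ∈ Y, ψ (w + w) v) = ∑ v ∈ Y, ψ (w + w) v := fun w => by
    rw [star_sum]; exact sum_congr rfl fun v _ => hreal2 w v
  have hpm : ∀ w : ZMod 4 × ZMod 4, ∀ a, ψ (w + w) a = 1 ∨ ψ (w + w) a = -1 := fun w a => by
    rw [hψ, z4pair_two]; exact ipow_two_mul_cases _
  -- (R) every real character `2v ≠ 0` is `1` on at most two of the five points
  have Rcard : ∀ v : ZMod 4 × ZMod 4, v + v ≠ 0 → (X'.filter fun y => ψ (v + v) (y - x₁) = 1).card ≤ 2 := by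
    intro v hv
    have hPP' := card_filter_add_card_filter_not (s := X') (fun y => ψ (v + v) (y - x₁) = 1)
    rw [hX'c] at hPP'
    have hS : ∑ y ∈ X', ψ (v + v) (y - x₁) = ((X'.filter fun y => ψ (v + v) (y - x₁) = 1).card : GaussianInt) -
        ((X'.filter fun y => ¬ ψ (v + v) (y - x₁) = 1).card : GaussianInt) := by
      rw [← sum_filter_add_sum_filter_not X' (fun y => ψ (v + v) (y - x₁) = 1)]
      have h1 : ∑ y ∈ X'.filter (fun y => ψ (v + v) (y - x₁) = 1), ψ (v + v) (y - x₁) =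
          ∑ y ∈ X'.filter (fun y => ψ (v + v) (y - x₁) = 1), (1 : GaussianInt) :=
        sum_congr rfl fun y hy => (mem_filter.1 hy).2
      have h2 : ∑ y ∈ X'.filter (fun y => ¬ ψ (v + v) (y - x₁) = 1), ψ (v + v) (y - x₁) =
          ∑ y ∈ X'.filter (fun y => ¬ ψ (v + v) (y - x₁) = 1), (-1 : GaussianInt) :=
        sum_congr rfl fun y hy => (hpm v (y - x₁)).resolve_left (mem_filter.1 hy).2
      rw [h1, h2, sum_const, sum_const, nsmul_eq_mul, nsmul_eq_mul, mul_one, mul_neg_one, sub_eq_add_neg]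
    have h := E' (v + v) hv
    have hstarS : star (1 + ψ (v + v) d₂ + ∑ y ∈ X', ψ (v + v) (y - x₁)) =
        1 + ψ (v + v) d₂ + ∑ y ∈ X', ψ (v + v) (y - x₁) := by
      rw [star_add, star_add, star_one, hreal2, star_sum]
      exact congrArg _ (sum_congr rfl fun y _ => hreal2 v (y - x₁))
    rw [hstarS, hrealY v, hd₂real v, hS] at h
    obtain ⟨u, hu⟩ : ∃ u, ψ (v + v) β' = u := ⟨_, rfl⟩
    obtain ⟨u', hu'⟩ : ∃ u', ψ (v + v) γ = u' := ⟨_, rfl⟩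
    have hr : ψ (v + v) e₀ = (⟨0, 1⟩ : GaussianInt) ^ ((v + v).1 * (φ e₀).1 + (v + v).2 * (φ e₀).2).val := hψ _ _
    rw [hu, hu', hr] at h
    have hk := int_eq_of_mul_eq_neg_ipow
      (2 + ((X'.filter fun y => ψ (v + v) (y - x₁) = 1).card : ℤ) -
        ((X'.filter fun y => ¬ ψ (v + v) (y - x₁) = 1).card : ℤ))
      ((∑ x ∈ Y, ψ (v + v) x) * (1 + u + u')) _ (by rw [← h]; push_cast; ring)
    omega
  -- coordinates `w, w'` dual to `(φ β', φ γ)` (the real characters forbid `(ψβ', ψγ) = (1,1)`)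
  have R2 : ∀ w : ZMod 4 × ZMod 4, w + w ≠ 0 → ¬ (ψ (w + w) β' = 1 ∧ ψ (w + w) γ = 1) := by
    rintro w hw ⟨h1, h2⟩
    have h := E' (w + w) hw
    rw [h1, h2, hrealY] at h
    simp only [star_add, star_one, hreal2, star_sum] at h
    apply three_mul_ne_neg_ipow ((1 + ψ (w + w) d₂ + ∑ y ∈ X', ψ (w + w) (y - x₁)) *
      ∑ v ∈ Y, ψ (w + w) v) ((w + w).1 * (φ e₀).1 + (w + w).2 * (φ e₀).2)
    rw [← hψ]; linear_combination h
  have e20 : ∀ q : ZMod 4 × ZMod 4, ((1, 0) + (1, 0) : ZMod 4 × ZMod 4).1 * q.1 +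
      ((1, 0) + (1, 0) : ZMod 4 × ZMod 4).2 * q.2 = 2 * q.1 + 0 * q.2 := fun q => by
    simp only [Prod.mk_add_mk]; ring
  have e02 : ∀ q : ZMod 4 × ZMod 4, ((0, 1) + (0, 1) : ZMod 4 × ZMod 4).1 * q.1 +
      ((0, 1) + (0, 1) : ZMod 4 × ZMod 4).2 * q.2 = 0 * q.1 + 2 * q.2 := fun q => by
    simp only [Prod.mk_add_mk]; ring
  have e22 : ∀ q : ZMod 4 × ZMod 4, ((1, 1) + (1, 1) : ZMod 4 × ZMod 4).1 * q.1 +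
      ((1, 1) + (1, 1) : ZMod 4 × ZMod 4).2 * q.2 = 2 * q.1 + 2 * q.2 := fun q => by
    simp only [Prod.mk_add_mk]; ring
  have R2' : ∀ w : ZMod 4 × ZMod 4, w + w ≠ 0 →
      ¬ ((⟨0, 1⟩ : GaussianInt) ^ ((w + w).1 * (φ β').1 + (w + w).2 * (φ β').2).val = 1 ∧
         (⟨0, 1⟩ : GaussianInt) ^ ((w + w).1 * (φ γ).1 + (w + w).2 * (φ γ).2).val = 1) := by
    intro w hw; rw [← hψ, ← hψ]; exact R2 w hw
  obtain ⟨w, w', hwP, hwQ, hw'P, hw'Q⟩ := exists_dual_pair (φ β') (φ γ)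
    (by rw [← e20, ← e20]; exact R2' _ (by decide))
    (by rw [← e02, ← e02]; exact R2' _ (by decide))
    (by rw [← e22, ← e22]; exact R2' _ (by decide))
  have hw'0 : w' ≠ 0 := by
    rintro rfl
    simp only [Prod.fst_zero, Prod.snd_zero, zero_mul, add_zero] at hw'Q; exact absurd hw'Q (by decide)
  -- the second character `W₂ = w' + 2w`
  have hW₂P : (w' + (w + w)).1 * (φ β').1 + (w' + (w + w)).2 * (φ β').2 = 2 := by
    rw [z4pair_add_left, z4pair_two, hw'P, hwP, mul_one, zero_add]
  have hW₂Q : (w' + (w + w)).1 * (φ γ).1 + (w' + (w + w)).2 * (φ γ).2 = 1 := by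
    rw [z4pair_add_left, z4pair_two, hw'Q, hwQ, mul_zero, add_zero]
  have hW₂0 : w' + (w + w) ≠ 0 := by
    intro h; rw [h] at hW₂Q
    simp only [Prod.fst_zero, Prod.snd_zero, zero_mul, add_zero] at hW₂Q; exact absurd hW₂Q (by decide)
  have hW₂pair : ∀ q : ZMod 4 × ZMod 4, (w' + (w + w)).1 * q.1 + (w' + (w + w)).2 * q.2 =
      (w'.1 * q.1 + w'.2 * q.2) + 2 * (w.1 * q.1 + w.2 * q.2) := fun q => by
    rw [z4pair_add_left, z4pair_two]
  -- non-vanishing of the three real characters `2w, 2w', 2(w+w')`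
  have h2w0 : w + w ≠ 0 := by
    intro h
    have := z4pair_two w (φ β')
    rw [h, hwP, mul_one] at this
    simp only [Prod.fst_zero, Prod.snd_zero, zero_mul, add_zero] at this; exact absurd this (by decide)
  have h2w'0 : w' + w' ≠ 0 := by
    intro h
    have := z4pair_two w' (φ γ)
    rw [h, hw'Q, mul_one] at this
    simp only [Prod.fst_zero, Prod.snd_zero, zero_mul, add_zero] at this; exact absurd this (by decide)
  have h2ww'0 : (w + w') + (w + w') ≠ 0 := by
    intro h
    have := z4pair_two (w + w') (φ β')
    rw [h, z4pair_add_left, hwP, hw'P, add_zero, mul_one] at this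
    simp only [Prod.fst_zero, Prod.snd_zero, zero_mul, add_zero] at this; exact absurd this (by decide)
  have hww' : ∀ a : A, (w + w').1 * (φ a).1 + (w + w').2 * (φ a).2 =
      (w.1 * (φ a).1 + w.2 * (φ a).2) + (w'.1 * (φ a).1 + w'.2 * (φ a).2) := fun a => z4pair_add_left w w' (φ a)
  -- the three classes of the five points
  set P₁ : Finset A := X'.filter fun y => ψ (w + w) (y - x₁) = 1 with hP₁
  set P₂ : Finset A := X'.filter fun y => ψ (w' + w') (y - x₁) = 1 with hP₂
  set P₃ : Finset A := X'.filter fun y => ψ ((w + w') + (w + w')) (y - x₁) = 1 with hP₃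
  have hcov' : ∀ y ∈ X', y ∈ P₁ ∨ y ∈ P₂ ∨ y ∈ P₃ := by
    intro y hy
    by_cases h1 : ψ (w + w) (y - x₁) = 1
    · exact Or.inl (mem_filter.2 ⟨hy, h1⟩)
    by_cases h2 : ψ (w' + w') (y - x₁) = 1
    · exact Or.inr (Or.inl (mem_filter.2 ⟨hy, h2⟩))
    refine Or.inr (Or.inr (mem_filter.2 ⟨hy, ?_⟩))
    rw [hψ2, hww']
    exact ipow_two_mul_add_eq_one _ _ (fun h => h1 ((hψ2 w _).trans h)) (fun h => h2 ((hψ2 w' _).trans h))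
  have h12' : ∀ y ∈ X', y ∈ P₁ → y ∈ P₂ → y ∈ P₃ := by
    intro y hy hy1 hy2
    refine mem_filter.2 ⟨hy, ?_⟩
    rw [hψ2, hww']
    exact ipow_two_mul_add_of_both _ _ ((hψ2 w _).symm.trans (mem_filter.1 hy1).2)
      ((hψ2 w' _).symm.trans (mem_filter.1 hy2).2)
  have h13' : ∀ y ∈ X', y ∈ P₁ → y ∈ P₃ → y ∈ P₂ := by
    intro y hy hy1 hy3
    refine mem_filter.2 ⟨hy, (hψ2 w' _).trans ?_⟩
    have h3 := (hψ2 (w + w') _).symm.trans (mem_filter.1 hy3).2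
    rw [hww'] at h3
    exact ipow_two_mul_of_fst _ _ ((hψ2 w _).symm.trans (mem_filter.1 hy1).2) h3
  have h23' : ∀ y ∈ X', y ∈ P₂ → y ∈ P₃ → y ∈ P₁ := by
    intro y hy hy2 hy3
    refine mem_filter.2 ⟨hy, (hψ2 w _).trans ?_⟩
    have h3 := (hψ2 (w + w') _).symm.trans (mem_filter.1 hy3).2
    rw [hww'] at h3
    exact ipow_two_mul_of_snd _ _ ((hψ2 w' _).symm.trans (mem_filter.1 hy2).2) h3
  obtain ⟨hd12, hd13, hd23, hU, hshape⟩ := three_parts_shape X' P₁ P₂ P₃ (filter_subset _ _) (filter_subset _ _)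
    (filter_subset _ _) hcov' h12' h13' h23' hX'c (Rcard w h2w0) (Rcard w' h2w'0) (Rcard (w + w') h2ww'0)
  have hsplit : ∀ W, ∑ y ∈ X', ψ W (y - x₁) =
      ∑ y ∈ P₁, ψ W (y - x₁) + ∑ y ∈ P₂, ψ W (y - x₁) + ∑ y ∈ P₃, ψ W (y - x₁) := fun W => by
    rw [← hU, sum_union (disjoint_union_left.2 ⟨hd13, hd23⟩), sum_union hd12]
  -- class parities from (non-)membership
  have mem₁ : ∀ y ∈ P₁, 2 * (w.1 * (φ (y - x₁)).1 + w.2 * (φ (y - x₁)).2) = 0 := fun y hy =>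
    two_mul_eq_zero_of_ipow _ ((hψ2 w _).symm.trans (mem_filter.1 hy).2)
  have mem₂ : ∀ y ∈ P₂, 2 * (w'.1 * (φ (y - x₁)).1 + w'.2 * (φ (y - x₁)).2) = 0 := fun y hy =>
    two_mul_eq_zero_of_ipow _ ((hψ2 w' _).symm.trans (mem_filter.1 hy).2)
  have nmem₁ : ∀ y ∈ X', y ∉ P₁ → 2 * (w.1 * (φ (y - x₁)).1 + w.2 * (φ (y - x₁)).2) = 2 := fun y hy hn =>
    two_mul_eq_two_of_ipow _ fun h => hn (mem_filter.2 ⟨hy, (hψ2 w _).trans h⟩)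
  have nmem₂ : ∀ y ∈ X', y ∉ P₂ → 2 * (w'.1 * (φ (y - x₁)).1 + w'.2 * (φ (y - x₁)).2) = 2 := fun y hy hn =>
    two_mul_eq_two_of_ipow _ fun h => hn (mem_filter.2 ⟨hy, (hψ2 w' _).trans h⟩)
  have hX₁ : ∀ y ∈ P₁, y ∈ X' := fun y hy => (mem_filter.1 hy).1
  have hX₂ : ∀ y ∈ P₂, y ∈ X' := fun y hy => (mem_filter.1 hy).1
  have hX₃ : ∀ y ∈ P₃, y ∈ X' := fun y hy => (mem_filter.1 hy).1
  -- the two identities, pairings of `β', γ` evaluated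
  have E1 := E' w' hw'0
  have E2 := E' (w' + (w + w)) hW₂0
  simp only [hψ] at E1 E2
  rw [hw'P, hw'Q, ipow_zmod_zero, ipow_zmod_one] at E1
  rw [hW₂P, hW₂Q, ipow_zmod_two, ipow_zmod_one] at E2
  -- the three shapes
  rcases hshape with ⟨c₁, c₂, c₃⟩ | ⟨c₁, c₂, c₃⟩ | ⟨c₁, c₂, c₃⟩
  · obtain ⟨y₃, hP₁e⟩ := card_eq_one.1 c₁
    obtain ⟨y₄, y₅, h45, hP₂e⟩ := card_eq_two.1 c₂
    obtain ⟨y₆, y₇, h67, hP₃e⟩ := card_eq_two.1 c₃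
    have hy₃ : y₃ ∈ P₁ := by rw [hP₁e]; exact mem_singleton_self _
    have hy₄ : y₄ ∈ P₂ := by rw [hP₂e]; exact mem_insert_self _ _
    have hy₅ : y₅ ∈ P₂ := by rw [hP₂e]; exact mem_insert_of_mem (mem_singleton_self _)
    have hy₆ : y₆ ∈ P₃ := by rw [hP₃e]; exact mem_insert_self _ _
    have hy₇ : y₇ ∈ P₃ := by rw [hP₃e]; exact mem_insert_of_mem (mem_singleton_self _)
    have hS : ∀ W : ZMod 4 × ZMod 4, ∑ y ∈ X', (⟨0, 1⟩ : GaussianInt) ^ (W.1 * (φ (y - x₁)).1 + W.2 * (φ (y - x₁)).2).val =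
        (⟨0, 1⟩ : GaussianInt) ^ (W.1 * (φ (y₃ - x₁)).1 + W.2 * (φ (y₃ - x₁)).2).val +
        (⟨0, 1⟩ : GaussianInt) ^ (W.1 * (φ (y₄ - x₁)).1 + W.2 * (φ (y₄ - x₁)).2).val +
        (⟨0, 1⟩ : GaussianInt) ^ (W.1 * (φ (y₅ - x₁)).1 + W.2 * (φ (y₅ - x₁)).2).val +
        (⟨0, 1⟩ : GaussianInt) ^ (W.1 * (φ (y₆ - x₁)).1 + W.2 * (φ (y₆ - x₁)).2).val +
        (⟨0, 1⟩ : GaussianInt) ^ (W.1 * (φ (y₇ - x₁)).1 + W.2 * (φ (y₇ - x₁)).2).val := fun W => by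
      have h := hsplit W
      simp only [hψ] at h
      rw [h, hP₁e, hP₂e, hP₃e, sum_singleton, sum_pair h45, sum_pair h67]; ring
    rw [hS] at E1 E2
    simp only [hW₂pair] at E2
    exact finish7A _ _ _ _ _ _ _ _ _ _ _ _ _ _ _ _ _ _ (htwo w) (htwo w')
      ⟨mem₁ y₃ hy₃, nmem₂ y₃ (hX₁ y₃ hy₃) (disjoint_left.1 hd12 hy₃)⟩
      ⟨nmem₁ y₄ (hX₂ y₄ hy₄) (fun h => disjoint_left.1 hd12 h hy₄), mem₂ y₄ hy₄⟩
      ⟨nmem₁ y₅ (hX₂ y₅ hy₅) (fun h => disjoint_left.1 hd12 h hy₅), mem₂ y₅ hy₅⟩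
      ⟨nmem₁ y₆ (hX₃ y₆ hy₆) (fun h => disjoint_left.1 hd13 h hy₆),
        nmem₂ y₆ (hX₃ y₆ hy₆) (fun h => disjoint_left.1 hd23 h hy₆)⟩
      ⟨nmem₁ y₇ (hX₃ y₇ hy₇) (fun h => disjoint_left.1 hd13 h hy₇),
        nmem₂ y₇ (hX₃ y₇ hy₇) (fun h => disjoint_left.1 hd23 h hy₇)⟩
      (by ring) (by ring) E1 E2
  · obtain ⟨y₃, y₄, h34, hP₁e⟩ := card_eq_two.1 c₁
    obtain ⟨y₅, hP₂e⟩ := card_eq_one.1 c₂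
    obtain ⟨y₆, y₇, h67, hP₃e⟩ := card_eq_two.1 c₃
    have hy₃ : y₃ ∈ P₁ := by rw [hP₁e]; exact mem_insert_self _ _
    have hy₄ : y₄ ∈ P₁ := by rw [hP₁e]; exact mem_insert_of_mem (mem_singleton_self _)
    have hy₅ : y₅ ∈ P₂ := by rw [hP₂e]; exact mem_singleton_self _
    have hy₆ : y₆ ∈ P₃ := by rw [hP₃e]; exact mem_insert_self _ _
    have hy₇ : y₇ ∈ P₃ := by rw [hP₃e]; exact mem_insert_of_mem (mem_singleton_self _)
    have hS : ∀ W : ZMod 4 × ZMod 4, ∑ y ∈ X', (⟨0, 1⟩ : GaussianInt) ^ (W.1 * (φ (y - x₁)).1 + W.2 * (φ (y - x₁)).2).val =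
        (⟨0, 1⟩ : GaussianInt) ^ (W.1 * (φ (y₃ - x₁)).1 + W.2 * (φ (y₃ - x₁)).2).val +
        (⟨0, 1⟩ : GaussianInt) ^ (W.1 * (φ (y₄ - x₁)).1 + W.2 * (φ (y₄ - x₁)).2).val +
        (⟨0, 1⟩ : GaussianInt) ^ (W.1 * (φ (y₅ - x₁)).1 + W.2 * (φ (y₅ - x₁)).2).val +
        (⟨0, 1⟩ : GaussianInt) ^ (W.1 * (φ (y₆ - x₁)).1 + W.2 * (φ (y₆ - x₁)).2).val +
        (⟨0, 1⟩ : GaussianInt) ^ (W.1 * (φ (y₇ - x₁)).1 + W.2 * (φ (y₇ - x₁)).2).val := fun W => by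
      have h := hsplit W
      simp only [hψ] at h
      rw [h, hP₁e, hP₂e, hP₃e, sum_pair h34, sum_singleton, sum_pair h67]; ring
    rw [hS] at E1 E2
    simp only [hW₂pair] at E2
    exact finish7B _ _ _ _ _ _ _ _ _ _ _ _ _ _ _ _ _ _ (htwo w) (htwo w')
      ⟨mem₁ y₃ hy₃, nmem₂ y₃ (hX₁ y₃ hy₃) (disjoint_left.1 hd12 hy₃)⟩
      ⟨mem₁ y₄ hy₄, nmem₂ y₄ (hX₁ y₄ hy₄) (disjoint_left.1 hd12 hy₄)⟩
      ⟨nmem₁ y₅ (hX₂ y₅ hy₅) (fun h => disjoint_left.1 hd12 h hy₅), mem₂ y₅ hy₅⟩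
      ⟨nmem₁ y₆ (hX₃ y₆ hy₆) (fun h => disjoint_left.1 hd13 h hy₆),
        nmem₂ y₆ (hX₃ y₆ hy₆) (fun h => disjoint_left.1 hd23 h hy₆)⟩
      ⟨nmem₁ y₇ (hX₃ y₇ hy₇) (fun h => disjoint_left.1 hd13 h hy₇),
        nmem₂ y₇ (hX₃ y₇ hy₇) (fun h => disjoint_left.1 hd23 h hy₇)⟩
      (by ring) (by ring) E1 E2
  · obtain ⟨y₃, y₄, h34, hP₁e⟩ := card_eq_two.1 c₁
    obtain ⟨y₅, y₆, h56, hP₂e⟩ := card_eq_two.1 c₂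
    obtain ⟨y₇, hP₃e⟩ := card_eq_one.1 c₃
    have hy₃ : y₃ ∈ P₁ := by rw [hP₁e]; exact mem_insert_self _ _
    have hy₄ : y₄ ∈ P₁ := by rw [hP₁e]; exact mem_insert_of_mem (mem_singleton_self _)
    have hy₅ : y₅ ∈ P₂ := by rw [hP₂e]; exact mem_insert_self _ _
    have hy₆ : y₆ ∈ P₂ := by rw [hP₂e]; exact mem_insert_of_mem (mem_singleton_self _)
    have hy₇ : y₇ ∈ P₃ := by rw [hP₃e]; exact mem_singleton_self _
    have hS : ∀ W : ZMod 4 × ZMod 4, ∑ y ∈ X', (⟨0, 1⟩ : GaussianInt) ^ (W.1 * (φ (y - x₁)).1 + W.2 * (φ (y - x₁)).2).val =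
        (⟨0, 1⟩ : GaussianInt) ^ (W.1 * (φ (y₃ - x₁)).1 + W.2 * (φ (y₃ - x₁)).2).val +
        (⟨0, 1⟩ : GaussianInt) ^ (W.1 * (φ (y₄ - x₁)).1 + W.2 * (φ (y₄ - x₁)).2).val +
        (⟨0, 1⟩ : GaussianInt) ^ (W.1 * (φ (y₅ - x₁)).1 + W.2 * (φ (y₅ - x₁)).2).val +
        (⟨0, 1⟩ : GaussianInt) ^ (W.1 * (φ (y₆ - x₁)).1 + W.2 * (φ (y₆ - x₁)).2).val +
        (⟨0, 1⟩ : GaussianInt) ^ (W.1 * (φ (y₇ - x₁)).1 + W.2 * (φ (y₇ - x₁)).2).val := fun W => by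
      have h := hsplit W
      simp only [hψ] at h
      rw [h, hP₁e, hP₂e, hP₃e, sum_pair h34, sum_pair h56, sum_singleton]; ring
    rw [hS] at E1 E2
    simp only [hW₂pair] at E2
    exact finish7C _ _ _ _ _ _ _ _ _ _ _ _ _ _ _ _ _ _ (htwo w) (htwo w')
      ⟨mem₁ y₃ hy₃, nmem₂ y₃ (hX₁ y₃ hy₃) (disjoint_left.1 hd12 hy₃)⟩
      ⟨mem₁ y₄ hy₄, nmem₂ y₄ (hX₁ y₄ hy₄) (disjoint_left.1 hd12 hy₄)⟩
      ⟨nmem₁ y₅ (hX₂ y₅ hy₅) (fun h => disjoint_left.1 hd12 h hy₅), mem₂ y₅ hy₅⟩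
      ⟨nmem₁ y₆ (hX₂ y₆ hy₆) (fun h => disjoint_left.1 hd12 h hy₆), mem₂ y₆ hy₆⟩
      ⟨nmem₁ y₇ (hX₃ y₇ hy₇) (fun h => disjoint_left.1 hd13 h hy₇),
        nmem₂ y₇ (hX₃ y₇ hy₇) (fun h => disjoint_left.1 hd23 h hy₇)⟩
      (by ring) (by ring) E1 E2

/-- **Core theorem, parts swapped**: the same with `|Y| = 7` (the identity is symmetric under `(X, β) ↔ (Y, γ)`).
[folklore] -/
theorem no_shifted_form_seven_of_onto_z4z4' (φ : A →+ ZMod 4 × ZMod 4) (hφ : Function.Surjective φ)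
    {X Y : Finset A} {β γ x₀ : A} (hY : Y.card = 7)
    (hinj : Set.InjOn (fun p : A × A => p.1 + p.2) ↑(X ×ˢ Y))
    (hPQ : Disjoint ((X ×ˢ Y).image fun p : A × A => p.1 + p.2)
      (((Y ×ˢ X).image fun p : A × A => p.1 - p.2).image fun z => z + β))
    (hPR : Disjoint ((X ×ˢ Y).image fun p : A × A => p.1 + p.2)
      (((X ×ˢ Y).image fun p : A × A => p.1 - p.2).image fun z => z + γ))
    (hQR : Disjoint (((Y ×ˢ X).image fun p : A × A => p.1 - p.2).image fun z => z + β)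
      (((X ×ˢ Y).image fun p : A × A => p.1 - p.2).image fun z => z + γ))
    (hcover : ((X ×ˢ Y).image fun p : A × A => p.1 + p.2) ∪
      (((Y ×ˢ X).image fun p : A × A => p.1 - p.2).image fun z => z + β) ∪
      (((X ×ˢ Y).image fun p : A × A => p.1 - p.2).image fun z => z + γ) = univ.erase x₀) : False := by
  have himg := image_add_swap X Y
  refine no_shifted_form_seven_of_onto_z4z4 φ hφ (X := Y) (Y := X) (β := γ) (γ := β) (x₀ := x₀) hY
    (injOn_add_swap hinj) ?_ ?_ hQR.symm ?_
  · rw [himg]; exact hPR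
  · rw [himg]; exact hPQ
  · rw [himg, union_right_comm]; exact hcover

end Main

end Summit.MatrixMultiplication.OmegaCensus
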